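import Summits.KontsevichZagierPeriods.KontsevichZagierPeriods.Cruxes.EffectiveXMapChains.SketchIdeator2

/-!
# Triage r1-3: the stub `ConnectedImageAfterDup` (card duplicate-to-kill-the-egg, SketchIdeator2.lean)
is MIS-STATED (strict `<` fails at the R₁-preimages of the real 4-torsion abscissae of the target,
where `x([2]·) = e` exactly). Witness: identity datum `(X, 1, 1)` on `y² = x³ − x`, `x = 1 + √2`, `e = 1`:
`R₂(1+√2) = ((1+√2)²+1)² / (4(1+√2)((1+√2)²−1)) = 1`.
Repair: add the hypothesis `W_comp x ≠ 0` (exclude critical points of the composite, which are cut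
points of the sheets anyway) or weaken to `≤` (cf. ideator 3's `root_le_dupX` / `root_lt_dupX (hW)`).
-/

open Polynomial

set_option linter.dupNamespace false

namespace Summit.KontsevichZagierPeriods.KontsevichZagierPeriods.Cruxes.EffectiveXMapChains.SketchIdeator2

/-- With `f₁ = X`, `g₁ = 1` the homogenised composition returns `f₂` itself. -/
theorem compNum_X_one (f₂ g₂ : ℚ[X]) : compNum X 1 f₂ g₂ = f₂ := by
  unfold compNum
  simp only [one_pow, mul_one]
  conv_rhs => rw [f₂.as_sum_range' (max f₂.natDegree g₂.natDegree + 1)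
    (Nat.lt_succ_of_le (le_max_left _ _))]
  refine Finset.sum_congr rfl fun i _ => ?_
  exact C_mul_X_pow_eq_monomial

/-- With `f₁ = X`, `g₁ = 1` the homogenised composition returns `g₂` itself. -/
theorem compDen_X_one (f₂ g₂ : ℚ[X]) : compDen X 1 f₂ g₂ = g₂ := by
  unfold compDen
  simp only [one_pow, mul_one]
  conv_rhs => rw [g₂.as_sum_range' (max f₂.natDegree g₂.natDegree + 1)
    (Nat.lt_succ_of_le (le_max_right _ _))]
  refine Finset.sum_congr rfl fun i _ => ?_
  exact C_mul_X_pow_eq_monomial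

/-- The identity certificate on `y² = x³ − x` is a datum. -/
theorem isDatum_id_lemn : IsDatum (-1) 0 (-1) 0 X 1 1 := by
  refine ⟨by simp, ?_⟩
  simp only [derivative_X, derivative_one, mul_one, mul_zero, sub_zero, one_pow, map_one]
  ring

/-- **`ConnectedImageAfterDup` is false as stated.** -/
theorem not_connectedImageAfterDup : ¬ ConnectedImageAfterDup := by
  intro h
  have hΔ : 4 * (-1 : ℤ) ^ 3 + 27 * (0 : ℤ) ^ 2 ≠ 0 := by norm_num
  have h1 := h (-1) 0 (-1) 0 X 1 1 hΔ hΔ isDatum_id_lemn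
  simp only [compNum_X_one, compDen_X_one] at h1
  set s : ℝ := Real.sqrt 2 with hs_def
  have hs : s ^ 2 = 2 := Real.sq_sqrt (by norm_num)
  have hs0 : 0 ≤ s := Real.sqrt_nonneg 2
  have hs1 : 1 < s := by nlinarith [hs, hs0, sq_nonneg (s - 1)]
  set x : ℝ := 1 + s with hx
  have hx0 : 0 < x := by rw [hx]; linarith
  have hx1 : 0 < x - 1 := by rw [hx]; linarith
  have hP' : 0 < x ^ 3 - x := by
    have e : x ^ 3 - x = x * (x - 1) * (x + 1) := by ring
    rw [e]
    exact mul_pos (mul_pos hx0 hx1) (by linarith)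
  have hP : 0 < x ^ 3 + ((-1 : ℤ) : ℝ) * x + ((0 : ℤ) : ℝ) := by
    push_cast; linarith [hP']
  -- evaluate f₂ = X⁴ − C(2A')X² − C(8B')X + C(A'²) and g₂ = 4(X³ + A'X + B') at x over ℝ
  have hf : ((X ^ 4 - C (2 * ((-1 : ℤ) : ℚ)) * X ^ 2 - C (8 * ((0 : ℤ) : ℚ)) * X +
      C (((-1 : ℤ) : ℚ) ^ 2) : ℚ[X]).map (algebraMap ℚ ℝ)).eval x = x ^ 4 + 2 * x ^ 2 + 1 := by
    simp
  have hg : ((C 4 * (X ^ 3 + C ((-1 : ℤ) : ℚ) * X + C ((0 : ℤ) : ℚ)) : ℚ[X]).map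
      (algebraMap ℚ ℝ)).eval x = 4 * (x ^ 3 - x) := by
    simp
    ring
  have hgne : ((C 4 * (X ^ 3 + C ((-1 : ℤ) : ℚ) * X + C ((0 : ℤ) : ℚ)) : ℚ[X]).map
      (algebraMap ℚ ℝ)).eval x ≠ 0 := by
    rw [hg]; exact (mul_pos (by norm_num) hP').ne'
  have h2 := h1 x hP hgne 1 (by push_cast; norm_num)
  rw [hf, hg] at h2
  -- but f₂(x) = g₂(x) at x = 1 + √2, so the quotient is 1: contradiction with 1 < 1
  have hkey : x ^ 4 + 2 * x ^ 2 + 1 = 4 * (x ^ 3 - x) := by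
    rw [hx]; linear_combination (s ^ 2 - 2) * hs
  have hpos : 0 < 4 * (x ^ 3 - x) := mul_pos (by norm_num) hP'
  rw [hkey, div_self hpos.ne'] at h2
  exact lt_irrefl _ h2

end Summit.KontsevichZagierPeriods.KontsevichZagierPeriods.Cruxes.EffectiveXMapChains.SketchIdeator2
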